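import Mathlib
import HarnessLib
import Summits.HubbardSuperconductivity.HubbardSuperconductivity.Theorems.KLProgrammeKLRegimeEngineV17F2ClosersVGQDoors
import Summits.HubbardSuperconductivity.HubbardSuperconductivity.Theorems.KLProgrammeKLRegimeEnginePairTransferPPRateSupport

/-!
# K3 ENGINE (stmt-HubbardSuperconductivity-20437 `KLRegimeEngineV17F2`, V2), row (c): the BALL-DATA DOOR of the flow frame — `∃ A₀, |K_n(p_k⃗)| ≤ A₀ ∧ Λₙ + A₀ ≤ e₀`
# under the registered doors (cell gate-hubbard-kl, seat hubbard-kl-k3c2-p2 g29; technique «thermal-bar induction n ≤ nScales β + 1 with EngineBoundsAtV4S sums»)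

WHY.  The producer-side bricks for the localisation rows (…PairTransferPPRateSupport/Window/Loc/DLine*: `klpr_hLr_of_ppProfile`, `klpr_hLr_of_pinningProfiles`,
`klpd_loc_of_pinningProfiles`) kill the off-ball part of the bracket through `klpr_mem_ball_of_rate_ne_zero`, which wants a frame bound `|K(p_k⃗)| ≤ A₀` with `Λₙ + A₀ ≤ e₀`.
For θ's frame `K_n = klFlowFrameU L M β U μ n` this holds at EVERY `n` under the registered doors: `n = 0`: `K₀ = 0` (`klFlowFrameU_zero`), `A₀ := 0`; `n ≥ 1`: θ's frame
window (`rowC_frameWindow`: `hAb` with `A = 2Gfr₀|U| + 2Gfr₁U² + Gfr₂·c/log 4`, `4A ≤ 1/20`) via `abs_frameShift_toLp_le` and `KLRegimeSplit.klpr_klScale_add_le_klE0`.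
(For the IN-class rows, which read `K_{n+1}`, the same door serves `n ≥ 1`; at `n = 0` the off-ball UV sliver is a separate geometric count — not here.)
One theorem, `rowC_ballData`; plumbing only; nothing asserts (c), K3 or superconductivity.  0 kit · 0 lit.
-/

noncomputable section

namespace Summit.HubbardSuperconductivity.HubbardSuperconductivity.Theorems.EngineV8

set_option linter.dupNamespace false -- summit = problem name (single-conjunct summit), D-0017

open Real Set Finset Literature.MathematicalPhysics.QuantumLattice
open Literature.Probability.LatticeModels hiding torusSupNorm
open Summit.HubbardSuperconductivity.HubbardSuperconductivity.Theorems.KLProgrammeLegKernels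
open Summit.HubbardSuperconductivity.HubbardSuperconductivity.Theorems.DispersionFlow
open Summit.HubbardSuperconductivity.HubbardSuperconductivity.Theorems.PerturbedFermiCurve
open Summit.HubbardSuperconductivity.HubbardSuperconductivity.Theorems.KLRegimeSplit

variable {L M : ℕ} [NeZero L] [NeZero M] (G : GeoConsts) {P : SplitConsts} {Q : EngConsts} {R : RenConsts} {c μ U β : ℝ}

/-- **Ball data of the flow frame**: `∃ A₀, (∀ k, |K_n(p_k⃗)| ≤ A₀) ∧ Λₙ + A₀ ≤ e₀` for `K_n = klFlowFrameU … n` under the registered doors (`n = 0`: `K₀ = 0`;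
`n ≥ 1`: `A₀ = 2Gfr₀|U| + 2Gfr₁U² + Gfr₂·c/log 4` with `4A₀ ≤ 1/20`, `rowC_frameWindow`). -/
theorem rowC_ballData (hR : R.WF2) (hc : 0 < c) (hc3 : c ≤ klEngC₃7GU G P R) (hμ : μ ∈ klWindowC) (hU : 0 < U)
    (hUle : U ≤ klEngU₀12GQ G Q P R c) (hβ : klBetaMin ≤ β) (hβc : β ≤ Real.exp (c / U ^ 2)) (hM : klEngM₃ β U L ≤ M)
    (n : ℕ) (hK : FrameOK R U (nScales β) μ (klFlowFrameU L M β U μ n)) :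
    ∃ A₀ : ℝ, (∀ k : TorusSite 2 L, |(klFlowFrameU L M β U μ n).eval (latticeMomentum L k)| ≤ A₀) ∧ klScale klE0 n + A₀ ≤ klE0 := by
  rcases Nat.eq_zero_or_pos n with h0 | hpos
  · subst h0
    refine ⟨0, fun k => ?_, ?_⟩
    · rw [klFlowFrameU_zero, TrigPolyC4v.eval_zero, abs_zero]
    · rw [klScale, pow_zero, inv_one, mul_one, add_zero]
  · obtain ⟨hAb, -, hA20, -⟩ := rowC_frameWindow G hR hc hc3 hμ hU hUle hβ hβc hM hK n
    refine ⟨_, fun k => ?_, KLRegimeSplit.klpr_klScale_add_le_klE0 hpos hA20⟩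
    have h := abs_frameShift_toLp_le hAb (latticeMomentum L k)
    rw [frameShift] at h
    simpa using h

end Summit.HubbardSuperconductivity.HubbardSuperconductivity.Theorems.EngineV8

end
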